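import Literature.NumberTheory.PAdicHodge.BmaxPlusFrobeniusEigenLog
import Literature.NumberTheory.PAdicHodge.BmaxPlusBdRModFilRing
import Literature.NumberTheory.PAdicHodge.BmaxPlusBdRModFilLog
import Literature.NumberTheory.PAdicHodge.BdRPlusLogTeich
import HarnessLib

/-!
# The image of `(A_max)^{φ=p}` in `B_dR⁺/Fil^k` lies in `ℚ_p ⊗ X⁰_k`, `X⁰_k = log[1 + p♭𝒪♭] mod Fil^k` — modulo Fontaine's kernel lemma

Topic `Literature/NumberTheory/PAdicHodge`; namespace `Literature.NumberTheory.PAdicHodge`. THEOREMS ONLY (no definition, no named fact, no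
instance, no `sorry`). Sequel of `BmaxPlusFrobeniusEigenLog` (`p^k x = c·t + p^j·Λ^{log}_1([w] − 1, z)` for every `x ∈ (A_max)^{φ=p}`, modulo the
Fontaine kernel `hFK`) transported along the comparison `B_max⁺ → B_dR⁺/Fil^k` (`BmaxPlusBdRModFil`, `…Ring`, `…Log`, `…LogType`): the φ-road's
`A_max`-periods land in the socket's currency `IsTeichLog k` (`BdRPlusLogTeich`: `L ≡ log[x] mod Fil^k`, `x₀ = 1`).

* ★★★ `exists_isTeichLog_of_bdR_lim_modFil_of_frobBmaxPlus_eq` — **modulo `hFK`**: for `x ∈ A_max` with `φx = p·x`, any `k`, and ANY limit `L ∈ B_dR⁺`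
  of `x` modulo `Fil^k` (`exists_bdR_lim_modFil`), there are `n ∈ ℕ` and `L′` with **`IsTeichLog k L′` and `p^n·L − L′ ∈ ξ^k B_dR⁺`**
  (the limit of `c·t` is `c·t_dR = log[ε^c]`, `bdR_lim_modFil_tBmax`; the limit of `Λ^{log}_1([w] − 1)` is `p·(log[w] mod Fil^k)`,
  `exists_isLogTypeModFil_of_bdR_lim_modFil_logSum`; the comparison is a ring map, `bdR_lim_modFil_add/_mul`, unique modulo `ξ^k`).

This is `(B⁺_cris)^{φ=p} ⊆ ℚ_p ⊗ log[1 + 𝔪_{ℂ♭}]` (Fontaine–Ouyang §6.1) read modulo `Fil^k` — the fragment of the fundamental exact sequence that the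
B8 assembly of the φ-road of line `kato_lever` consumes (crux K★ `stmt-BirchSwinnertonDyer-22226`, memo
`Summits/…/Cruxes/StarredOptimalManinUnitFiveSeven/Lines/kato-lever-K3-legendre.md` §7.3 (iii)): applied to the Legendre resolution
`x̃(a) = D(ũ, a) ∈ (A_max)^{φ=p}` (`BmaxPlusFormalLogDivisionTower.frobBmaxPlus_det_logSum_divisionLiftPt`) it yields `IsTeichLog 2 (p^n·x̃(a))`, i.e.
the socket's (K₂), once (TDIV) supplies `hFK`. Infrastructure only; BSD / K★ are not proved by any of this.

## References
* J.-M. Fontaine, Y. Ouyang, *Theory of p-adic Galois representations*, §6.1. [FontaineOuyang2022]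
* J.-M. Fontaine, *Le corps des périodes p-adiques*, Astérisque 223 (1994), Exp. II §1.5.3–1.5.4, Exp. III Th. 5.3.7. [FontaineAsterisque223III]
* P. Colmez, *Théorie d'Iwasawa des représentations de de Rham d'un corps local*, Ann. of Math. 148 (1998), §III.2. [Colmez1998Annals]
-/

noncomputable section

open WittVector Field ValuativeRel Finset
open Literature.AlgebraicGeometry.Resolution
open Literature.RingTheory.FormalGroups

namespace Literature.NumberTheory.PAdicHodge

open Literature.NumberTheory.GaloisRepresentations
open Literature.NumberTheory.GaloisRepresentations.IsNonarchimedeanLocalField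
open GaloisContinuity

variable {F : Type} [Field F] [ValuativeRel F] [TopologicalSpace F] [IsNonarchimedeanLocalField F]
  [CharZero F] {p : ℕ} [Fact p.Prime] [Fact (¬ IsUnit (p : integerC F))]
  [IsAdicComplete (Ideal.span {(p : integerC F)}) (integerC F)]

set_option maxHeartbeats 3200000 in
set_option synthInstance.maxHeartbeats 400000 in
/-- ★★★ **The image of `(A_max)^{φ=p}` in `B_dR⁺/Fil^k` is contained in `ℚ_p ⊗ X⁰_k` — modulo Fontaine's kernel lemma.** Assume `hFK`
(`φy = py ∧ θy = 0 ⇒ p^m y = c·t`, `BmaxPlusFontaineKernel.fontaineKernel_of_tBmax_dvd` ⟸ (TDIV)). Let `x ∈ A_max = B_max⁺(F)` with `φ(x) = p·x`,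
`k ∈ ℕ`, and let `L ∈ B_dR⁺` be a limit of `x` modulo `Fil^k` with shift `r` (`exists_bdR_lim_modFil`). Then for some `n ∈ ℕ` and some
`L′ ∈ B_dR⁺` with `IsTeichLog k L′` (a Teichmüller logarithm `log[x′] mod Fil^k`, `x′₀ = 1`): **`p^n·L − L′ ∈ ξ^k·B_dR⁺`**. Proof:
`p^{k₀} x = c·t + p^j Λ^{log}_1([w] − 1)` (`exists_pow_mul_eq_tBmax_add_logSum_of_frobBmaxPlus_eq`); the comparison is a ring map modulo `Fil^k`
(`bdR_lim_modFil_ainfToBmaxPlus/_mul/_add`) sending `t ↦ t_dR` (`bdR_lim_modFil_tBmax`) and `Λ^{log}_1([w] − 1) ↦ p·L″`, `L″` a logarithm of `[w]`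
(`exists_isLogTypeModFil_of_bdR_lim_modFil_logSum`), and limits are unique modulo `ξ^k` (`sub_mem_span_xiBdR_pow_of_bdR_lim_modFil`); finally
`c·t_dR = log[ε^c]` and `p^{j+1}·L″` are Teichmüller logarithms (`isTeichLog_smul_tBdR`, `IsTeichLog.natCast_mul`, `.add`).
[cite: FontaineOuyang2022, §6.1] [cite: FontaineAsterisque223III, Exp. II §1.5.4 and Exp. III Th. 5.3.7] -/
theorem exists_isTeichLog_of_bdR_lim_modFil_of_frobBmaxPlus_eq (hp : valuation F p < 1)
    (hFK : ∀ y : BmaxPlus F p, frobBmaxPlus F p y = (p : BmaxPlus F p) * y → thetaBmaxPlus F p y = 0 →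
      ∃ (k : ℕ) (c : ℤ_[p]), (p : BmaxPlus F p) ^ k * y = ainfToBmaxPlus F p (zpToAinf c) * tBmax)
    {x : BmaxPlus F p} (hx : frobBmaxPlus F p x = (p : BmaxPlus F p) * x) {k : ℕ}
    {L : BDeRhamPlus (integerC F) p} {r : ℕ}
    (hL : ∀ N M : ℕ, N + r ≤ M → ∀ y : bmaxZero F p,
      AdicCompletion.evalₐ (Ideal.span {(p : bmaxZero F p)}) M x = Ideal.Quotient.mk _ y →
      ∃ (a : Ainf (p := p) F) (w : BDeRhamPlus (integerC F) p),
        (p : BDeRhamPlus (integerC F) p) ^ k *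
            (L - algebraMap (Localization.Away (p : Ainf (p := p) F)) (BDeRhamPlus (integerC F) p)
              (y : Localization.Away (p : Ainf (p := p) F))) =
          ainfToBdR ((p : Ainf (p := p) F) ^ N * a) + xiBdR ^ k * w) :
    ∃ (n : ℕ) (L' : BDeRhamPlus (integerC F) p),
      IsTeichLog k L' ∧ (p : BDeRhamPlus (integerC F) p) ^ n * L - L' ∈ Ideal.span {(xiBdR : BDeRhamPlus (integerC F) p) ^ k} := by
  -- `p^{k₀} x = c·t + p^j Λ` in `A_max`
  obtain ⟨k₀, j, c, w, z, hmem, hz, heq⟩ := exists_pow_mul_eq_tBmax_add_logSum_of_frobBmaxPlus_eq hp hFK hx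
  set Λ := PadicLogSeries.logSum ((algebraMap (Ainf (p := p) F) (bmaxZero F p)).comp zpToAinf)
    (fun m => if m = 0 then 0 else (-1) ^ (m + 1)) 1
    (algebraMap (Ainf (p := p) F) (bmaxZero F p) ((teichmuller p w : Ainf (p := p) F) - 1)) z with hΛ
  have heq' : ainfToBmaxPlus F p ((p : Ainf (p := p) F) ^ k₀) * x =
      ainfToBmaxPlus F p (zpToAinf c) * tBmax + ainfToBmaxPlus F p ((p : Ainf (p := p) F) ^ j) * Λ := by
    rw [map_pow, map_natCast, map_pow, map_natCast]; exact heq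
  -- limits modulo `Fil^k` of the three pieces
  obtain ⟨r₀, hL0⟩ := bdR_lim_modFil_mul (bdR_lim_modFil_ainfToBmaxPlus ((p : Ainf (p := p) F) ^ k₀) k) hL
  rw [heq'] at hL0
  obtain ⟨r₁, hL1⟩ := bdR_lim_modFil_mul (bdR_lim_modFil_ainfToBmaxPlus (zpToAinf c) k) (bdR_lim_modFil_tBmax (F := F) (p := p) k)
  obtain ⟨LΛ, rΛ, hLΛ⟩ := exists_bdR_lim_modFil Λ k
  obtain ⟨r₂, hL2⟩ := bdR_lim_modFil_mul (bdR_lim_modFil_ainfToBmaxPlus ((p : Ainf (p := p) F) ^ j) k) hLΛ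
  have hsum := bdR_lim_modFil_add hL1 hL2
  -- uniqueness of limits modulo `ξ^k`
  have hdiff := sub_mem_span_xiBdR_pow_of_bdR_lim_modFil hL0 hsum
  -- the limit of `Λ^{log}_1([w] − 1)` is `p·L″`, `L″` a logarithm of `[w]` modulo `Fil^k`
  obtain ⟨L'', hL''eq, hL''⟩ := exists_isLogTypeModFil_of_bdR_lim_modFil_logSum (fun m => if m = 0 then 0 else (-1) ^ (m + 1))
    le_rfl ((teichmuller p w : Ainf (p := p) F) - 1) hz hLΛ
  have hL''' : IsLogModFil k ((teichmuller p w : Ainf (p := p) F) - 1) L'' := by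
    rw [← isLogTypeModFil_neg_one_pow_iff]
    exact isLogTypeModFil_congr (fun m hm => by rw [if_neg hm]) hL''
  have hT'' : IsTeichLog k L'' := ⟨w, (teichmuller_sub_one_mem_span_p_xi_iff_coeff_zero w).1 hmem, hL'''⟩
  -- the Teichmüller logarithm `L′ = c·t_dR + p^{j+1}·L″`
  have hT : IsTeichLog k (qpToBdR (c : ℚ_[p]) * tBdR + ((p ^ (j + 1) : ℕ) : BDeRhamPlus (integerC F) p) * L'') :=
    (isTeichLog_smul_tBdR k c).add (hT''.natCast_mul (p ^ (j + 1)))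
  refine ⟨k₀, _, hT, ?_⟩
  have e : (p : BDeRhamPlus (integerC F) p) ^ k₀ * L - (qpToBdR (c : ℚ_[p]) * tBdR + ((p ^ (j + 1) : ℕ) : BDeRhamPlus (integerC F) p) * L'') =
      ainfToBdR ((p : Ainf (p := p) F) ^ k₀) * L - (ainfToBdR (zpToAinf c) * tBdR + ainfToBdR ((p : Ainf (p := p) F) ^ j) * LΛ) := by
    rw [qpToBdR_coe, ← hL''eq, map_pow, map_natCast, map_pow, map_natCast, Nat.cast_pow, pow_succ, pow_one]
    ring
  rw [e]
  exact hdiff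

end Literature.NumberTheory.PAdicHodge

end
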